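import Literature.Computability.Cryptography.ClassBQP
import Literature.Computability.Cryptography.Postselection
import Literature.Computability.Complexity.Counting
import Literature.Computability.Complexity.Oracle
import Literature.Computability.Complexity.ProbabilisticClasses
import HarnessLib

-- provenance: harness21/H21/H21/Statements/QuantumAdvantage/CountingSimulation.lean @ 42d7803 (interim HEAD d8f2665); M5 mechanical rewrite
/-!
# Counting simulations of quantum polynomial time (family QuantumAdvantage, outline §3)

Target statements relating `BQP` and its postselected version to the classical counting classes
`PP`, `PP^{BQP}` and `AWPP`:

* **quantum-advantage.S16** `PostBQP_eq_PP`: Aaronson's theorem `PostBQP = PP`;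
* **quantum-advantage.S17** `iUnion_PPRel_BQP_eq_PP`: Fortnow–Rogers, `PP^{BQP} = PP`
  (`BQP` is low for `PP`), together with `BQP_subset_AWPP : BQP ⊆ AWPP`;
* `AWPP`: Fenner's `GapP` characterisation of the class `AWPP` of Fenner–Fortnow–Kurtz–Li, and
  `AWPP_subset_PP`.

## Sources

* S. Aaronson, *Quantum computing, postselection, and probabilistic polynomial-time*,
  Proc. R. Soc. A 461 (2005), 3473–3482, Thm. 2 (`PostBQP = PP`).
* L. Fortnow, J. Rogers, *Complexity limitations on quantum computation*, J. Comput. System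
  Sci. 59 (1999), 240–252: Thm. 1.1 / Cor. 4.3 (`BQP ⊆ AWPP`, `PP^{BQP} = PP`).
* S. Fenner, L. Fortnow, S. Kurtz, L. Li, *An oracle builder's toolkit*, Inform. and Comput.
  182 (2003), 95–136, §5 (definition of `AWPP`, `AWPP ⊆ APP ⊆ PP`).
* S. Fenner, *PP-lowness and a simple definition of AWPP*, Theory Comput. Syst. 36 (2003),
  199–212, Thm. 1.2 / Cor. 3.2 (`AWPP` with a single `GapP` function, error `1/3` and dyadic
  denominators `2^{p(|x|)}`).
* L. Li, *On the counting functions*, PhD thesis, U. Chicago (1993), §5 (`AWPP ⊆ PP`).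

## Mathlib

Mathlib has `Language` and `Polynomial.eval` but no complexity classes (searched: `PostBQP`,
`AWPP`, `GapP`, ` PP `, `BQP`). All classes come from H21: `PostBQP`, `PostBQP_eq_PP`
(CryptoQuantFine Q4 `Postselection`), `BQP` (Q3 `ClassBQP`), `PP` (G01 `ProbabilisticClasses`),
`GapP`, `PPRel` (G01 `Counting`), `Oracle.ofLanguage` (G01 `Oracle`).

## Design choices

* S16 is *restated* here in the statements namespace with its inventory id; the theorem itself
  is the prelude API lemma `Literature.Computability.Cryptography.PostBQP_eq_PP` of Q4, and the proof is that
  lemma (so this file adds no new `sorry` for S16). Both constants have the same short name;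
  qualify it when both `Literature.QuantumAdvantage` and `Literature.CryptoQuantFine` are open.
* `BQP ⊆ PP` (Adleman–DeMarrais–Huang) is *not* restated here: it is
  `Literature.Computability.QuantumComplexity.BQP_subset_PP` in `Statements/QuantumAdvantage/BQP.lean` (S06 chain);
  it also follows from this file as `BQP_subset_AWPP.trans AWPP_subset_PP`.
* `PP^{BQP}` is written literally as `⋃ L ∈ BQP, PPRel (Oracle.ofLanguage L)` (G01 has
  `PRelClass`, `NPRelClass`, `BPPRelClass` but no `PPRelClass`; we do not introduce a one-use
  definition).
* `AWPP` is *defined* by Fenner's 2003 characterisation (one `GapP` function `g`, a polynomial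
  `p`, thresholds `2/3 · 2^{p|x|} ≤ g x ≤ 2^{p|x|}` on members and `0 ≤ g x ≤ 1/3 · 2^{p|x|}` on
  non-members), written multiplicatively in `ℤ` (no division, no `ℕ` subtraction). The original
  FFKL definition (error `2^{-r}` for every polynomial `r`, arbitrary poly-time computable
  positive denominators) is equivalent (Fenner 2003, Thm. 1.2); this is recorded in the
  docstring rather than proved.
* Class names are the customary acronyms (`AWPP`), the documented deviation from lowerCamelCase
  shared with G01's `P`, `NP`, `PP` and Q3's `BQP`.
-/

open Computability Literature.Computability.Complexity Literature.Computability.Cryptography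

namespace Literature.Computability.QuantumComplexity

/-! ### S16: PostBQP = PP -/

/-- **quantum-advantage.S16** (Aaronson's theorem; Aaronson 2005, Thm. 2). Bounded-error
quantum polynomial time with postselection equals probabilistic polynomial time:
`PostBQP = PP` (for the gate set Clifford+T fixed in `PostBQP`, and more generally for any
universal gate set with algebraic amplitudes). The proof is the prelude lemma
`Literature.Computability.Cryptography.PostBQP_eq_PP` (same short name: qualify when both namespaces are
open). [cite: Aaronson2005, Thm. 2] -/
def PostBQP_eq_PP : Prop :=
  PostBQP = PP

/- interim proof relied on results that are now named facts (D-0014); demoted to a fact by the M5 import, proof preserved: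
:=
  Literature.CryptoQuantFine.PostBQP_eq_PP
-/

/-! ### The class AWPP -/

/-- **AWPP** ("almost-wide PP"), in Fenner's `GapP` form: `L ∈ AWPP` iff there are `g ∈ GapP`
and a polynomial `p` such that for every `x`,
`x ∈ L → 2/3 ≤ g(x) / 2^{p(|x|)} ≤ 1` and `x ∉ L → 0 ≤ g(x) / 2^{p(|x|)} ≤ 1/3`
(written multiplicatively in `ℤ`). This is equivalent to the original definition of
Fenner–Fortnow–Kurtz–Li (error `2^{-r(|x|)}` for every polynomial `r`, with an arbitrary
polynomial-time computable positive denominator in place of `2^{p(|x|)}`): the error can be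
amplified and the denominator made dyadic. `AWPP` is the smallest classical class known to
contain `BQP`, and every language in it is low for `PP`.
[Fenner 2003, Thm. 1.2 and Cor. 3.2; Fenner–Fortnow–Kurtz–Li 2003, §5] [cite: Fenner2003, Thm. 1.2 and Cor. 3.2] -/
noncomputable def AWPP : Set (Language Bool) :=
  {L | ∃ g ∈ GapP, ∃ p : Polynomial ℕ, ∀ x : List Bool,
    (x ∈ L → 2 * (2 : ℤ) ^ p.eval x.length ≤ 3 * g x ∧ g x ≤ (2 : ℤ) ^ p.eval x.length) ∧
    (x ∉ L → 0 ≤ g x ∧ 3 * g x ≤ (2 : ℤ) ^ p.eval x.length)}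

/-- Unfolding lemma for `AWPP`. [Fenner 2003, Thm. 1.2] [cite: Fenner2003, Thm. 1.2] -/
theorem mem_AWPP_iff {L : Language Bool} :
    L ∈ AWPP ↔ ∃ g ∈ GapP, ∃ p : Polynomial ℕ, ∀ x : List Bool,
      (x ∈ L → 2 * (2 : ℤ) ^ p.eval x.length ≤ 3 * g x ∧ g x ≤ (2 : ℤ) ^ p.eval x.length) ∧
      (x ∉ L → 0 ≤ g x ∧ 3 * g x ≤ (2 : ℤ) ^ p.eval x.length) :=
  Iff.rfl

/-! ### S17: PP^BQP = PP and BQP ⊆ AWPP -/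

/-- **quantum-advantage.S17** (Fortnow–Rogers 1999, Cor. 4.3: `PP^{BQP} = PP`, i.e. `BQP` is
low for `PP`). The union over all `L ∈ BQP` of `PP` relative to the characteristic-function
oracle of `L` is exactly `PP`. (The inclusion `⊇` is the trivial one: `PP = PP^∅` and
`∅ ∈ BQP`.) [Fortnow–Rogers, JCSS 59 (1999), Thm. 1.1(2), Cor. 4.3] [cite: FortnowRogers1999, Cor. 4.3:  PP^{BQP} = PP   i.e.  BQP  is] -/
def iUnion_PPRel_BQP_eq_PP : Prop :=
  (⋃ L ∈ BQP, PPRel (Oracle.ofLanguage L)) = PP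

/-- **quantum-advantage.S17** (second clause; Fortnow–Rogers 1999, Thm. 1.1(1) / Thm. 3.5):
`BQP ⊆ AWPP` — the acceptance probability of a poly-time uniform Clifford+T circuit family is
`g(x) / 2^{p(|x|)}` for a `GapP` function `g` (amplitudes of Clifford+T gates lie in
`ℤ[1/√2, i]`; after the standard real-amplitude and dyadic normalisation, and error reduction
to `1/3`, one obtains Fenner's form). [Fortnow–Rogers, JCSS 59 (1999), Thm. 3.5;
Fenner 2003, Cor. 3.2] [cite: Fenner2003, Cor. 3.2] -/
def BQP_subset_AWPP : Prop :=
  BQP ⊆ AWPP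

/-- `AWPP ⊆ PP`: if `g ∈ GapP` and `p` witness `L ∈ AWPP` then
`x ∈ L ↔ 0 < 2 · g(x) - 2^{p(|x|)}`, and `2 g - 2^{p}` is again in `GapP`, so `L ∈ PP` by the
`GapP` characterisation of `PP` (`mem_PP_iff_gapP`). [Fenner–Fortnow–Kurtz–Li 2003, §5
(`AWPP ⊆ APP ⊆ PP`); Li 1993, §5; Fenner–Fortnow–Kurtz 1994, §4 (closure properties of
`GapP`)] [cite: FennerFortnowKurtzLi2003, §5 ( AWPP ⊆ APP ⊆ PP] -/
def AWPP_subset_PP : Prop :=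
  AWPP ⊆ PP

end Literature.Computability.QuantumComplexity
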